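import Summits.AtomisticToContinuum.HydrodynamicLimit.Theorems.StiffCollisionalRelaxationAprioriBoundsMesoVarianceEquilibrium
import Summits.AtomisticToContinuum.HydrodynamicLimit.Theorems.BoxDissipativeWeakStrongLocalGibbsFineScaleStaticsPrelim
import Summits.AtomisticToContinuum.HydrodynamicLimit.Theorems.BoxDissipativeWeakStrongLocalGibbsFineScaleUniformTwoPt
import HarnessLib

/-!
# Variance of the kernel block density at time zero under the local Gibbs law of a general profile
# (plumbing (d)+(e) of the `s = 0` inhomogeneous rung of stub `stub_mesoVariance`, line `meso-chebyshev-window`,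
# crux `AprioriBounds`, stmt-AtomisticToContinuum-14827)

Helper file (`--supports stmt-AtomisticToContinuum-14827`).  Stub 3 of the line asks for
`MemLp ρ̄_φ(s,x) 2 P_N ∧ Var_{P_N} ρ̄_φ(s,x) ≤ A (N+1)^{3γ-1}` for the kernel block density
`ρ̄_φ(s,x)(z) = empiricalDensityField (Φ.flow s z) (fun y => φ (y - x)) = (N+1)⁻¹ ∑ᵢ φ(qᵢ(s) − x)` under the local
Gibbs law `P_N = localGibbsLaw σ a₀ u₀ θ₀ N Φ` of GENERAL continuous positive profiles `(a₀, u₀, θ₀)`.  This file is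
the measure-theoretic plumbing of the `s = 0` instance, the inhomogeneous analogue of §4 and of the `MemLp` bullet of
`…AprioriBoundsMesoVarianceEquilibrium` (where the profiles are constant and the law is flow invariant):

* (e1) `tzVar_variance_blockDensity_flow_zero_eq`: at time `0` the flow is the identity almost surely
  (`localGibbsLaw_preimage_flow_zero`: `Φ_0 = id` on the good set, conull for the absolutely continuous law), so
  `Φ.flow 0` preserves `P_N` (`tzVar_measurePreserving_flow_zero`); the observable is positional and the position
  marginal of `P_N` is the configurational canonical gas `posGibbsMeasure a₀ ε_N (N+1)` for EVERY continuous profile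
  (`LGFS.map_pos_localGibbsMeasure`, `tzVar_measurePreserving_pos`).  Hence
  `Var_{P_N} ρ̄_φ(0,x) = Var_{posGibbs} ((N+1)⁻¹ ∑ᵢ φ(qᵢ − x))`.
* (d) `tzVar_variance_avg_posGibbs_le`: for a measurable kernel `0 ≤ χ ≤ K`, small reduced density and `N ≥ 1`,
  `Var_{posGibbs} ((N+1)⁻¹ ∑ᵢ χ(qᵢ)) ≤ (N+1)⁻¹ · 2K ∫χ dμ + |E_{N+1}[χ(x₀)χ(x₁)] − E_{N+1}[χ(x₀)]²|`
  (`μ` the one-particle law of `profileOf a₀`): `Var X ≤ E(X − m)²` at `m = E_{N+1}[χ(x₀)] = onePt … χ N 0`, the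
  cluster-expansion normalisation `LGFS.integral_posGibbs_eq`, the exchangeability identity `variance_identity` of
  `HardSphereEulerLLN` (`tzVar_integral_sq_sub_onePt_posGibbs_eq`), the diagonal bound `LGFS.onePt_sq_le`
  (`E[χ²] ≤ 2K∫χ`) and `E[χ(x₀)χ(x₁)] ≥ 0` (`tzVar_twoPt_nonneg`).  The quantitative bound on the truncated two-point
  function is NOT here (it is the lead's `…MesoTwoPtTruncated`).
* (e2) `tzVar_memLp_blockDensity_flow`: `ρ̄_φ(s,x) ∈ L²(P_N)` at every time (bounded by `sup |φ|`, measurable;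
  `σ ≤ 1/2` makes `P_N` a probability law).

No definitions, no named facts; axioms `propext`, `Classical.choice`, `Quot.sound`.  References: H. Spohn, *Large Scale
Dynamics of Interacting Particles* (1991), Part I §2.3; E. Pulvirenti, D. Tsagkarogiannis, Comm. Math. Phys. 316 (2012)
289–306, §3.
-/

noncomputable section

open MeasureTheory ProbabilityTheory Filter Set Topology
open scoped ENNReal

namespace Summit.AtomisticToContinuum.HydrodynamicLimit.Theorems.MesoChebyshevWindow

open Literature.MathematicalPhysics.KineticTheory Literature.Analysis.FluidPDE
open Literature.MathematicalPhysics.StatisticalMechanics Literature.Probability.LatticeModels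

/-! ## (e1) Time zero: from the local Gibbs law to the configurational canonical gas -/

/-- **The time-`0` map of a hard-sphere flow preserves the local Gibbs law** (every profile, every `σ`):
`Φ_0 = id` on the good set, which is conull for the (absolutely continuous) law
(`localGibbsLaw_preimage_flow_zero`). -/
theorem tzVar_measurePreserving_flow_zero (σ : ℝ) (a₀ : T3 → ℝ) (u₀ : T3 → V3) (θ₀ : T3 → ℝ) (N : ℕ)
    (Φ : HardSphereFlow (Torus.geometry (Fin 3)) (hsDiameter σ N) (N + 1)) :
    MeasurePreserving (Φ.flow 0) (localGibbsLaw σ a₀ u₀ θ₀ N Φ) (localGibbsLaw σ a₀ u₀ θ₀ N Φ) := by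
  refine ⟨Φ.measurable_flow 0, Measure.ext fun A hA => ?_⟩
  rw [Measure.map_apply (Φ.measurable_flow 0) hA, localGibbsLaw_preimage_flow_zero,
    ← localGibbsLaw_eq σ a₀ u₀ θ₀ N Φ]

/-- **The position marginal of the local Gibbs law is the configurational canonical gas**, for general
continuous profiles `a₀ ≥ 0`, `θ₀ > 0`: `q_# P_N = posGibbsMeasure a₀ ε_N (N+1)` for `q(z) = (xᵢ)ᵢ`
(`LGFS.map_pos_localGibbsMeasure` through `localGibbsLaw_eq`). -/
theorem tzVar_measurePreserving_pos {σ : ℝ} {a₀ θ₀ : T3 → ℝ} {u₀ : T3 → V3}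
    (ha : Continuous a₀) (hθ : Continuous θ₀) (hu : Continuous u₀) (ha0 : ∀ x, 0 ≤ a₀ x)
    (hθ0 : ∀ x, 0 < θ₀ x) (N : ℕ) (Φ : HardSphereFlow (Torus.geometry (Fin 3)) (hsDiameter σ N) (N + 1)) :
    MeasurePreserving (fun (z : Config (N + 1) (Fin 3) T3) (i : Fin (N + 1)) => (z i).1)
      (localGibbsLaw σ a₀ u₀ θ₀ N Φ) (posGibbsMeasure a₀ (hsDiameter σ N) (N + 1)) := by
  refine ⟨LGFS.measurable_posProj (N + 1), ?_⟩
  rw [localGibbsLaw_eq]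
  exact LGFS.map_pos_localGibbsMeasure ha hθ hu ha0 hθ0 σ N

/-- **(e1) At time `0` the variance of the kernel block density under the local Gibbs law is the variance of
the position average under the configurational canonical measure**:
`Var_{P_N} ρ̄_φ(0,x) = Var_{posGibbs a₀ ε_N (N+1)} ((N+1)⁻¹ ∑ᵢ φ(qᵢ − x))` — `Φ.flow 0` preserves `P_N`
(`tzVar_measurePreserving_flow_zero`), the block density is the position average of the position projection
(`AprioriBoundsNegative.blockDensity_eq`), whose law is the canonical gas (`tzVar_measurePreserving_pos`). -/
theorem tzVar_variance_blockDensity_flow_zero_eq {σ : ℝ} {a₀ θ₀ : T3 → ℝ} {u₀ : T3 → V3}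
    (ha : Continuous a₀) (hθ : Continuous θ₀) (hu : Continuous u₀) (ha0 : ∀ x, 0 < a₀ x) (hθ0 : ∀ x, 0 < θ₀ x)
    (N : ℕ) (Φ : HardSphereFlow (Torus.geometry (Fin 3)) (hsDiameter σ N) (N + 1)) {φ : T3 → ℝ} (hφ : Continuous φ)
    (x : T3) :
    variance (fun z => empiricalDensityField (Φ.flow 0 z) (fun y => φ (y - x))) (localGibbsLaw σ a₀ u₀ θ₀ N Φ) =
      variance (fun q : Fin (N + 1) → T3 => (((N + 1 : ℕ) : ℝ))⁻¹ * ∑ i, φ (q i - x))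
        (posGibbsMeasure a₀ (hsDiameter σ N) (N + 1)) := by
  have hFqm : Measurable fun q : Fin (N + 1) → T3 => (((N + 1 : ℕ) : ℝ))⁻¹ * ∑ i, φ (q i - x) :=
    measurable_const.mul (Finset.measurable_sum _ fun i _ =>
      (hφ.comp (continuous_sub_right x)).measurable.comp (measurable_pi_apply i))
  -- the block density is the position average `(N+1)⁻¹ ∑ᵢ φ(qᵢ - x)` of the position projection
  have hF : (fun z : Config (N + 1) (Fin 3) T3 => empiricalDensityField z (fun y => φ (y - x))) =
      fun z => (((N + 1 : ℕ) : ℝ))⁻¹ * ∑ i, φ ((z i).1 - x) :=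
    funext fun z => AprioriBoundsNegative.blockDensity_eq z φ x
  -- (1) `Φ_0 = id` almost surely: the law is invariant under `Φ.flow 0`
  have h1 : variance (fun z => empiricalDensityField (Φ.flow 0 z) (fun y => φ (y - x)))
      (localGibbsLaw σ a₀ u₀ θ₀ N Φ) =
      variance (fun z : Config (N + 1) (Fin 3) T3 => empiricalDensityField z (fun y => φ (y - x)))
        (localGibbsLaw σ a₀ u₀ θ₀ N Φ) :=
    (tzVar_measurePreserving_flow_zero σ a₀ u₀ θ₀ N Φ).variance_fun_comp
      (measurable_blockDensity_cfg hφ x).aemeasurable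
  -- (2) the position marginal is the canonical gas
  have h2 := (tzVar_measurePreserving_pos ha hθ hu (fun y => (ha0 y).le) hθ0 N Φ).variance_fun_comp
    hFqm.aemeasurable
  rw [h1, hF, h2]

/-! ## (d) The variance of a kernel average under the canonical gas -/

/-- The two-point expectation `E_{N+1}[χ(x₀)χ(x₁)] = twoPt P σ χ N` of a nonnegative kernel is nonnegative
(small reduced density, so that `Ξ_N(N+1) > 0`; the junk value at `N = 0` is `0`). -/
theorem tzVar_twoPt_nonneg {P : DensityProfile} {σ : ℝ} (hs : SmallDensity P σ) {χ : T3 → ℝ}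
    (hχ0 : ∀ y, 0 ≤ χ y) (N : ℕ) : 0 ≤ twoPt P σ χ N := by
  rw [twoPt]
  split_ifs with h2
  · exact div_nonneg (integral_nonneg fun q => mul_nonneg (mul_nonneg (hχ0 _) (hχ0 _)) (efR_nonneg _ _))
      (XiN_pos hs.σ_pos.le hs.σ_lt_half hs.ovDensity_lt_one le_rfl).le
  · exact le_rfl

/-- **The variance identity under the configurational canonical gas** (exchangeability, `variance_identity` of
`HardSphereEulerLLN`, in the normalisation `LGFS.integral_posGibbs_eq`): for `N ≥ 1`, measurable `χ` with
`|χ| ≤ K` and `m = E_{N+1}[χ(x₀)] = onePt P σ χ N 0` (`P = profileOf a₀`),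
`∫ ((N+1)⁻¹ ∑ᵢ χ(qᵢ) − m)² dposGibbs = (N+1)⁻¹ E[χ(x₀)²] + (1 − (N+1)⁻¹) E[χ(x₀)χ(x₁)] − 2 m·m + m²`. -/
theorem tzVar_integral_sq_sub_onePt_posGibbs_eq {a₀ : T3 → ℝ} (ha : Continuous a₀) (ha0 : ∀ x, 0 < a₀ x)
    {σ : ℝ} (hs : SmallDensity (profileOf a₀ ha ha0) σ) {N : ℕ} (hN : 1 ≤ N) {χ : T3 → ℝ}
    (hχ : Measurable χ) {K : ℝ} (hχK : ∀ y, |χ y| ≤ K) :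
    ∫ q, ((((N + 1 : ℕ) : ℝ))⁻¹ * ∑ i, χ (q i) - onePt (profileOf a₀ ha ha0) σ χ N 0) ^ 2
        ∂posGibbsMeasure a₀ (hsDiameter σ N) (N + 1) =
      (((N + 1 : ℕ) : ℝ))⁻¹ * onePt (profileOf a₀ ha ha0) σ (fun y => χ y ^ 2) N 0 +
        (1 - (((N + 1 : ℕ) : ℝ))⁻¹) * twoPt (profileOf a₀ ha ha0) σ χ N -
        2 * onePt (profileOf a₀ ha ha0) σ χ N 0 * onePt (profileOf a₀ ha ha0) σ χ N 0 +
        onePt (profileOf a₀ ha ha0) σ χ N 0 ^ 2 := by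
  set P := profileOf a₀ ha ha0 with hP
  have h2 : 2 ≤ N + 1 := by omega
  have hXi := XiN_pos hs.σ_pos.le hs.σ_lt_half hs.ovDensity_lt_one (N := N) (m := N + 1) le_rfl
  set m := onePt P σ χ N 0 with hm
  rw [hP, LGFS.integral_posGibbs_eq ha ha0, ← hP, inv_mul_eq_div, XiN,
    variance_identity P (hsDiameter σ N) h2 hχ hχK m (by rw [← XiN]; exact hXi.ne')]
  have hq : Md P (hsDiameter σ N) (N + 1) (fun y => χ y ^ 2) (N + 1) / Xi P (hsDiameter σ N) (N + 1) (N + 1) =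
      onePt P σ (fun y => χ y ^ 2) N 0 := by rw [onePt, XiN]; rfl
  have hm' : Md P (hsDiameter σ N) (N + 1) χ (N + 1) / Xi P (hsDiameter σ N) (N + 1) (N + 1) = m := by
    rw [hm, onePt, XiN]; rfl
  have ht : (∫ q, χ (q 0) * χ (q ⟨1, h2⟩) * efR (Ov (hsDiameter σ N)) q Finset.univ
      ∂Measure.pi (fun _ : Fin (N + 1) => P.μ)) / Xi P (hsDiameter σ N) (N + 1) (N + 1) =
      twoPt P σ χ N := by rw [twoPt, dif_pos h2, XiN]
  rw [hq, hm', ht]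

/-- **(d) Variance of a kernel average under the canonical gas: diagonal term plus truncated two-point
function.**  For a continuous positive activity `a₀`, small reduced density (`SmallDensity (profileOf a₀) σ`),
`N ≥ 1` and a measurable kernel `0 ≤ χ ≤ K`:
`Var_{posGibbs a₀ ε_N (N+1)} ((N+1)⁻¹ ∑ᵢ χ(qᵢ)) ≤ (N+1)⁻¹ · (2K ∫ χ dμ) + |E_{N+1}[χ(x₀)χ(x₁)] − E_{N+1}[χ(x₀)]²|`:
`Var X ≤ E(X − m)²` at `m = E_{N+1}[χ(x₀)]`, the variance identity (`tzVar_integral_sq_sub_onePt_posGibbs_eq`)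
`= (N+1)⁻¹ (E[χ²] − E[χχ]) + (E[χχ] − m²)`, `E[χ²] ≤ 2K∫χ dμ` (`LGFS.onePt_sq_le`) and `E[χχ] ≥ 0`. -/
theorem tzVar_variance_avg_posGibbs_le {a₀ : T3 → ℝ} (ha : Continuous a₀) (ha0 : ∀ x, 0 < a₀ x) {σ : ℝ}
    (hs : SmallDensity (profileOf a₀ ha ha0) σ) {N : ℕ} (hN : 1 ≤ N) {χ : T3 → ℝ} (hχ : Measurable χ) {K : ℝ}
    (hχ0 : ∀ y, 0 ≤ χ y) (hχK : ∀ y, χ y ≤ K) :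
    variance (fun q : Fin (N + 1) → T3 => (((N + 1 : ℕ) : ℝ))⁻¹ * ∑ i, χ (q i))
        (posGibbsMeasure a₀ (hsDiameter σ N) (N + 1)) ≤
      (((N + 1 : ℕ) : ℝ))⁻¹ * (2 * K * ∫ y, χ y ∂(profileOf a₀ ha ha0).μ) +
        |twoPt (profileOf a₀ ha ha0) σ χ N - onePt (profileOf a₀ ha ha0) σ χ N 0 ^ 2| := by
  haveI : IsProbabilityMeasure (posGibbsMeasure a₀ (hsDiameter σ N) (N + 1)) :=
    isProbabilityMeasure_posGibbsMeasure ha ha0 hs.σ_lt_half.le N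
  have hχK' : ∀ y, |χ y| ≤ K := LGFS.abs_le_of_nonneg_of_le hχ0 hχK
  have hFqm : Measurable fun q : Fin (N + 1) → T3 => (((N + 1 : ℕ) : ℝ))⁻¹ * ∑ i, χ (q i) :=
    LGFS.measurable_avg hχ
  -- `Var X ≤ E (X - m)²`
  have h3 : variance (fun q : Fin (N + 1) → T3 => (((N + 1 : ℕ) : ℝ))⁻¹ * ∑ i, χ (q i))
      (posGibbsMeasure a₀ (hsDiameter σ N) (N + 1)) ≤
      ∫ q, ((((N + 1 : ℕ) : ℝ))⁻¹ * ∑ i, χ (q i) - onePt (profileOf a₀ ha ha0) σ χ N 0) ^ 2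
        ∂posGibbsMeasure a₀ (hsDiameter σ N) (N + 1) := by
    rw [← variance_sub_const hFqm.aestronglyMeasurable (onePt (profileOf a₀ ha ha0) σ χ N 0)]
    have h := variance_le_expectation_sq (μ := posGibbsMeasure a₀ (hsDiameter σ N) (N + 1))
      (X := fun q : Fin (N + 1) → T3 =>
        (((N + 1 : ℕ) : ℝ))⁻¹ * ∑ i, χ (q i) - onePt (profileOf a₀ ha ha0) σ χ N 0)
      (hFqm.aestronglyMeasurable.sub aestronglyMeasurable_const)
    simpa only [Pi.pow_apply] using h
  -- bounds on the pieces of the variance identity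
  have hsq : onePt (profileOf a₀ ha ha0) σ (fun y => χ y ^ 2) N 0 ≤ 2 * K * ∫ y, χ y ∂(profileOf a₀ ha ha0).μ :=
    LGFS.onePt_sq_le hs hχ hχ0 hχK (Nat.zero_le N)
  have hn0 : 0 ≤ (((N + 1 : ℕ) : ℝ))⁻¹ := by positivity
  have hdiag := mul_le_mul_of_nonneg_left hsq hn0
  have htwo := mul_nonneg hn0 (tzVar_twoPt_nonneg hs hχ0 N)
  have habs := le_abs_self (twoPt (profileOf a₀ ha ha0) σ χ N - onePt (profileOf a₀ ha ha0) σ χ N 0 ^ 2)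
  refine h3.trans ?_
  rw [tzVar_integral_sq_sub_onePt_posGibbs_eq ha ha0 hs hN hχ hχK']
  linarith

/-! ## (e2) Square integrability of the block density along the flow -/

/-- **(e2) The kernel block density along the flow is in `L²` of the local Gibbs law**: for `σ ≤ 1/2`
(probability law), continuous positive profiles, every flow, time `s`, centre `x` and continuous kernel `φ` with
`|φ| ≤ K`, `ρ̄_φ(s,x) ∈ L²(P_N)` — it is bounded by `K` (`abs_blockDensity_le`) and measurable
(`measurable_blockDensity_cfg` composed with the measurable time-`s` map). -/
theorem tzVar_memLp_blockDensity_flow {σ : ℝ} (hσ2 : σ ≤ 1 / 2) {a₀ θ₀ : T3 → ℝ} {u₀ : T3 → V3}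
    (ha : Continuous a₀) (hθ : Continuous θ₀) (hu : Continuous u₀) (ha0 : ∀ x, 0 < a₀ x) (hθ0 : ∀ x, 0 < θ₀ x)
    (N : ℕ) (Φ : HardSphereFlow (Torus.geometry (Fin 3)) (hsDiameter σ N) (N + 1)) {φ : T3 → ℝ} (hφ : Continuous φ)
    {K : ℝ} (hK : ∀ y, |φ y| ≤ K) (s : ℝ) (x : T3) :
    MemLp (fun z => empiricalDensityField (Φ.flow s z) (fun y => φ (y - x))) 2 (localGibbsLaw σ a₀ u₀ θ₀ N Φ) := by
  haveI : IsProbabilityMeasure (localGibbsLaw σ a₀ u₀ θ₀ N Φ) :=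
    isProbabilityMeasure_localGibbsLaw ha hθ hu ha0 hθ0 hσ2 N Φ
  exact memLp_of_bounded (a := -K) (b := K)
    (ae_of_all _ fun z => abs_le.1 (abs_blockDensity_le hK (Φ.flow s z) x))
    (((measurable_blockDensity_cfg hφ x).comp (Φ.measurable_flow s)).aestronglyMeasurable) 2

/-! ## Registered sub-stub (closed form of (d)) -/

/-- **Registered sub-stub of this helper file** (line `meso-chebyshev-window`, toward stub `stub_mesoVariance`, `s = 0`
inhomogeneous rung): the closed `∀`-form of (d) `tzVar_variance_avg_posGibbs_le` — for a continuous positive activity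
`a₀`, small reduced density, `N ≥ 1` and a measurable kernel `0 ≤ χ ≤ K`,
`Var_{posGibbs a₀ ε_N (N+1)} ((N+1)⁻¹ ∑ᵢ χ(qᵢ)) ≤ (N+1)⁻¹ (2K ∫χ dμ) + |E_{N+1}[χ(x₀)χ(x₁)] − E_{N+1}[χ(x₀)]²|`. -/
theorem varianceTimeZeroBridge : ∀ (a₀ : T3 → ℝ) (ha : Continuous a₀) (ha0 : ∀ x, 0 < a₀ x) (σ : ℝ), SmallDensity (profileOf a₀ ha ha0) σ → ∀ (N : ℕ), 1 ≤ N → ∀ (χ : T3 → ℝ) (K : ℝ), Measurable χ → (∀ y, 0 ≤ χ y) → (∀ y, χ y ≤ K) → variance (fun q : Fin (N + 1) → T3 => (((N + 1 : ℕ) : ℝ))⁻¹ * ∑ i, χ (q i)) (posGibbsMeasure a₀ (hsDiameter σ N) (N + 1)) ≤ (((N + 1 : ℕ) : ℝ))⁻¹ * (2 * K * ∫ y, χ y ∂(profileOf a₀ ha ha0).μ) + |twoPt (profileOf a₀ ha ha0) σ χ N - onePt (profileOf a₀ ha ha0) σ χ N 0 ^ 2| :=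
  fun _ ha ha0 _ hs _ hN _ _ hχ hχ0 hχK => tzVar_variance_avg_posGibbs_le ha ha0 hs hN hχ hχ0 hχK

end Summit.AtomisticToContinuum.HydrodynamicLimit.Theorems.MesoChebyshevWindow

end
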